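import Literature.Analysis.FluidPDE.LatticeShearWords
import Mathlib.Analysis.SpecialFunctions.Pow.Real
import Mathlib.Analysis.SpecificLimits.Basic
import HarnessLib

/-!
# K3L `LagrangianCarrierConstruction` (stmt-AnomalousDissipation-24913), line `birth`, stub `stub_bookkeepingL`:
# level arithmetic of the doubly-exponential bookkeeping family (helper; `--supports stmt-AnomalousDissipation-24913`)

Summits-side helper file (everything proved; no definitions, no named facts). Elementary lemmas consumed by the
construction of the registered stub `stub_bookkeepingL` (files `…LagrangianCarrierConstructionBookkeepingCore`,
`…LagrangianCarrierConstructionBookkeepingL`):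
* sixteenth roots of sixteenth powers (the template (T2)–(T5) reads the level ratio `N_{m+1}/N_m = b^16` through
  `(·)^(1/4)`, `(·)^(1/16)`, and the decay clause through `(·)^(1 − 1/16)`);
* the physical period of a level in terms of the bookkeeping, `physPeriod m = period / (kbar_m N_m²)`;
* exponent identities of the tower `2^m`;
* ONE LEVEL of the family: with `σ² = cM`, ratio root `b ≥ max(2, M)` and `M(c+1) ≤ b^16`, the cell viscosity
  `ν = √(cM/(b^24 − M))` is squeezed `σ/b^12 ≤ ν ≤ 1/b^4` and realises the Taylor gain `1 + c/ν² = b^24/M` EXACTLY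
  (so that the period ratio `b^32 · M/b^24 = M b^8` is an integer);
* a doubling sequence is dominated by twice its last term; a halving positive sequence tends to `0`.
This is bookkeeping for the construction side of route-1's rung leaf F-D1.A0 (a frontier formal rung); it is NOT a proof of
anomalous dissipation.
-/

set_option linter.dupNamespace false

noncomputable section

namespace Summit.AnomalousDissipation.AnomalousDissipation.Theorems.SolenoidalFractalHomogenisation.LagrangianCarrierConstruction

open Filter Topology
open Literature.Analysis.FluidPDE Literature.Analysis.FluidPDE.LatticeShear
/-- Sixteenth root of a sixteenth power. [folklore] -/
theorem rpow_pow_sixteen_inv {x : ℝ} (hx : 0 ≤ x) : (x ^ 16) ^ (1 / 16 : ℝ) = x := by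
  have h := Real.pow_rpow_inv_natCast hx (show (16:ℕ) ≠ 0 by norm_num)
  have e : ((16:ℕ) : ℝ)⁻¹ = (1 / 16 : ℝ) := by norm_num
  rw [e] at h
  exact h

/-- Fourth root of a sixteenth power. [folklore] -/
theorem rpow_pow_sixteen_quarter {x : ℝ} (hx : 0 ≤ x) : (x ^ 16) ^ (1 / 4 : ℝ) = x ^ 4 := by
  have h := Real.pow_rpow_inv_natCast (pow_nonneg hx 4) (show (4:ℕ) ≠ 0 by norm_num)
  have e : ((4:ℕ) : ℝ)⁻¹ = (1 / 4 : ℝ) := by norm_num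
  rw [e, ← pow_mul] at h
  exact h

/-- `(x^16)^(1 − 1/16) = x^15`. [folklore] -/
theorem rpow_pow_sixteen_dec {x : ℝ} (hx : 0 ≤ x) : (x ^ 16) ^ (1 - 1 / 16 : ℝ) = x ^ 15 := by
  rw [← Real.rpow_natCast x 16, ← Real.rpow_mul hx]
  norm_num

/-- The physical period of level `m` in terms of the bookkeeping: `physPeriod m = period / (kbar_m N_m²)`
(the quasi-static stretch `1/cellVisc m = a_m/(kbar_m N_m²)` of the word, divided by the shear rate `a_m`). [folklore] -/
theorem physPeriod_eq {k : ℕ} (D : FractalCarrierData k) (m : ℕ) :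
    D.physPeriod m = D.design.period / (D.kbar m * (D.N m : ℝ) ^ 2) := by
  unfold FractalCarrierData.physPeriod FractalCarrierData.word FractalCarrierData.slotStretch
  have hper : ∀ (s : ℝ) (hs : 0 < s), (D.design.stretch s hs).period = s * D.design.period := fun s hs => by
    unfold LatticeWord.period LatticeWord.stretch
    simp [Finset.mul_sum]
  rw [hper]
  unfold FractalCarrierData.cellVisc
  have ha : D.a m ≠ 0 := (D.a_pos m).ne'
  have hk : D.kbar m ≠ 0 := (D.kbar_pos m).ne'
  have hN : (D.N m : ℝ) ≠ 0 := by exact_mod_cast (D.N_pos m).ne'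
  field_simp

/-- `2^(m+1) − 1 = (2^m − 1) + 2^m`. [folklore] -/
theorem two_pow_succ_sub_one (m : ℕ) : 2 ^ (m + 1) - 1 = (2 ^ m - 1) + 2 ^ m := by
  have h : 1 ≤ 2 ^ m := Nat.one_le_two_pow
  rw [pow_succ]
  omega

/-- `m + 1 ≤ 2^(m+1) − 1`. [folklore] -/
theorem succ_le_two_pow_succ_sub_one (m : ℕ) : m + 1 ≤ 2 ^ (m + 1) - 1 := by
  have h : m + 1 < 2 ^ (m + 1) := Nat.lt_two_pow_self
  omega

/-- `12 · 2^m = 6 + 6 · (2^(m+1) − 1)`. [folklore] -/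
theorem twelve_mul_two_pow (m : ℕ) : 12 * 2 ^ m = 6 + 6 * (2 ^ (m + 1) - 1) := by
  have h : 1 ≤ 2 ^ m := Nat.one_le_two_pow
  rw [pow_succ]
  omega

/-- **One level of the family.** With `σ² = cM` (`σ > 0`, `M ≥ 1`), a ratio root `b ≥ 2`, `b ≥ M` and
`M(c+1) ≤ b^16`, the cell viscosity `ν = √(cM/(b^24 − M))` of the next level is well defined and positive, squeezed
`σ/b^12 ≤ ν ≤ 1/b^4` (hence `1/ν ≤ b^12/σ`), and realises the Taylor gain `1 + c/ν² = b^24/M` exactly. [folklore] -/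
theorem level_viscosity {c M σ b : ℝ} (hc : 0 < c) (hM : 1 ≤ M) (hσ : σ ^ 2 = c * M) (hσ0 : 0 < σ)
    (hb : 2 ≤ b) (hbM : M ≤ b) (hb16 : M * (c + 1) ≤ b ^ 16) :
    0 < b ^ 24 - M ∧ 0 < Real.sqrt (c * M / (b ^ 24 - M)) ∧
    Real.sqrt (c * M / (b ^ 24 - M)) ^ 2 = c * M / (b ^ 24 - M) ∧
    σ / b ^ 12 ≤ Real.sqrt (c * M / (b ^ 24 - M)) ∧
    Real.sqrt (c * M / (b ^ 24 - M)) ≤ 1 / b ^ 4 ∧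
    1 / Real.sqrt (c * M / (b ^ 24 - M)) ≤ b ^ 12 / σ ∧
    1 + c / Real.sqrt (c * M / (b ^ 24 - M)) ^ 2 = b ^ 24 / M := by
  have hM0 : 0 < M := by linarith
  have hb1 : 1 ≤ b := by linarith
  have hb0 : 0 < b := by linarith
  have hcM0 : 0 ≤ c * M := by positivity
  have h2M : 2 * M ≤ b ^ 24 :=
    calc 2 * M ≤ b * b := mul_le_mul hb hbM hM0.le hb0.le
      _ = b ^ 2 := by ring
      _ ≤ b ^ 24 := pow_le_pow_right₀ hb1 (by norm_num)
  have hden : 0 < b ^ 24 - M := by linarith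
  have hνpos : 0 < Real.sqrt (c * M / (b ^ 24 - M)) := Real.sqrt_pos.2 (div_pos (by positivity) hden)
  have hνsq : Real.sqrt (c * M / (b ^ 24 - M)) ^ 2 = c * M / (b ^ 24 - M) :=
    Real.sq_sqrt (div_nonneg hcM0 hden.le)
  have hνlo : σ / b ^ 12 ≤ Real.sqrt (c * M / (b ^ 24 - M)) := by
    rw [Real.le_sqrt (by positivity) (div_nonneg hcM0 hden.le), div_pow, hσ, ← pow_mul,
      show 12 * 2 = 24 from rfl]
    exact div_le_div_of_nonneg_left hcM0 hden (by linarith)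
  have hνhi : Real.sqrt (c * M / (b ^ 24 - M)) ≤ 1 / b ^ 4 := by
    rw [Real.sqrt_le_left (by positivity), div_pow, one_pow, ← pow_mul,
      div_le_div_iff₀ hden (by positivity), one_mul]
    have e : b ^ 24 = b ^ 16 * b ^ (4 * 2) := by rw [← pow_add]
    rw [e]
    have hb8 : (1:ℝ) ≤ b ^ (4 * 2) := one_le_pow₀ hb1
    nlinarith [hM0, hc, hb8]
  refine ⟨hden, hνpos, hνsq, hνlo, hνhi, ?_, ?_⟩
  · rw [div_le_div_iff₀ hνpos hσ0, one_mul]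
    have := (div_le_iff₀ (pow_pos hb0 12)).1 hνlo
    linarith
  · rw [hνsq]
    have h1 : (b ^ 24 - M) ≠ 0 := hden.ne'
    field_simp
    ring

/-- A positive sequence that at least doubles from index `1` on is dominated by twice its last term:
`a_1 + ⋯ + a_{m+1} ≤ 2 a_{m+1}`. [folklore] -/
theorem sum_range_le_two_mul_of_double {a : ℕ → ℝ} (h1 : 0 ≤ a 1)
    (h : ∀ m, 2 * a (m + 1) ≤ a (m + 1 + 1)) :
    ∀ m, ∑ i ∈ Finset.range (m + 1), a (i + 1) ≤ 2 * a (m + 1) := by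
  intro m
  induction m with
  | zero => rw [zero_add, Finset.sum_range_one]; linarith
  | succ n ih =>
    rw [Finset.sum_range_succ]
    have := h n
    linarith

/-- A nonnegative sequence with `u_{m+1} ≤ u_m/2` tends to `0`. [folklore] -/
theorem tendsto_zero_of_succ_le_half {u : ℕ → ℝ} (hpos : ∀ m, 0 ≤ u m) (h : ∀ m, u (m + 1) ≤ u m / 2) :
    Tendsto u atTop (𝓝 0) := by
  have hbound : ∀ m, u m ≤ u 0 * (1 / 2) ^ m := by
    intro m
    induction m with
    | zero => simp
    | succ n ih =>
      calc u (n + 1) ≤ u n / 2 := h n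
        _ ≤ u 0 * (1 / 2) ^ n / 2 := by linarith
        _ = u 0 * (1 / 2) ^ (n + 1) := by rw [pow_succ]; ring
  have hlim : Tendsto (fun m => u 0 * (1 / 2 : ℝ) ^ m) atTop (𝓝 0) := by
    have h := (tendsto_pow_atTop_nhds_zero_of_lt_one (by norm_num : (0 : ℝ) ≤ 1 / 2)
      (by norm_num : (1 / 2 : ℝ) < 1)).const_mul (u 0)
    rw [mul_zero] at h
    exact h
  exact squeeze_zero hpos hbound hlim

end Summit.AnomalousDissipation.AnomalousDissipation.Theorems.SolenoidalFractalHomogenisation.LagrangianCarrierConstruction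

end
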